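import Summits.MatrixMultiplication.MatrixMultiplication.Theorems.AbelianSTPPCensusTAKnapSound
import Summits.MatrixMultiplication.MatrixMultiplication.Theorems.AbelianSTPPCensusTAKnapEvalA
import Summits.MatrixMultiplication.MatrixMultiplication.Theorems.AbelianSTPPCensusTAKnapEvalB
import Summits.MatrixMultiplication.MatrixMultiplication.Theorems.AbelianSTPPCensusTAKnapEvalC
import Summits.MatrixMultiplication.MatrixMultiplication.Theorems.AbelianSTPPCensusTAKnapEvalD
import Summits.MatrixMultiplication.MatrixMultiplication.Theorems.AbelianSTPPCensusLeafSiblingsClosed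
import Summits.MatrixMultiplication.MatrixMultiplication.Theorems.AbelianSTPPCensusGlue
import Summits.MatrixMultiplication.MatrixMultiplication.Theorems.AbelianSTPPCensusSieveRulesReversal

/-!
# Rung leaf T_A/450 closed: no abelian STPP host of order `≤ 450` beats `τ = 2.371`

Cell mm-stpp (rung F-M1, D-0059/D-0061), registered ALT-CLOSER list-4 leaf `NoAbelianSTPPHost_2371_450` (`AbelianSTPPCensusTargets.lean`;
director-frontier 2026-08-26T14:59:40Z GO): for every finite abelian group `H` with `|H| ≤ 450` and every STPP family `(A_i,B_i,C_i)` in `H`,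
`Σ_i (|A_i||B_i||C_i|)^{2.371/3} ≤ |H|`.  Assembly:
* `|H| ≤ 337`: `noAbelianSTPPHostUpTo_2371_337` (T_E/337 `noAbelianSTPPHost_250_337`, route `AbelianSTPPCensusVP`, by exponent monotonicity;
  `AbelianSTPPCensusLeafSiblingsClosed.lean`);
* `338 ≤ |H| ≤ 450`: degenerate and one-member families by `AbelianTECensus.noAbelianSTPPHostUpTo_of_two`; otherwise vM soundness
  `AbelianTECensus.sieveSound` (`IsSTPP ⇒ SieveAdmissible`) and the knapsack certificate — `TAKnap.checked_all` chains the five kernel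
  segments `TAKnap.seg1 … seg5` through `TAKnap.seg_sound`, and `TAKnap.not_beats_of_checked` turns them into `¬ Beats (2371/1000) M`.
WHAT THIS IS NOT: no bound on `ω` (a rung leaf, never summit credit); nothing about orders `> 450`; nothing about the alive `5/2` lists of
the census (`338`, primes `521/523`, …).
-/

set_option linter.dupNamespace false
set_option autoImplicit false

namespace Summit.MatrixMultiplication.MatrixMultiplication.Theorems

namespace TAKnap

/-! ## All volumes are checked for the orders `338 … 450` (chaining the five kernel segments) -/

/-- Every volume `1 … 450` is `Checked` for the orders `338, …, 450` (`338 + 113 = 451`): the segment evaluations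
`seg1 … seg5` chained through `seg_sound` from `inv_row0`. [original] -/
theorem checked_all : ∀ V, 1 ≤ V → V ≤ Mtop → Checked 338 113 V := by
  have s1 := seg_sound (lo := 338) (n := 113) (by norm_num) (by simpa using inv_row0) seg1
  have s2 := seg_sound (by norm_num) (by simpa using s1.1) seg2
  have s3 := seg_sound (by norm_num) (by simpa using s2.1) seg3
  have s4 := seg_sound (by norm_num) (by simpa using s3.1) seg4
  have s5 := loopVR_sound 338 113 120 331 row330 (by norm_num) (by simpa using s4.1) seg5
  intro V h1 h2
  simp only [Mtop] at h2
  rcases Nat.lt_or_ge V 29 with h | h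
  · exact s1.2 V h1 (by omega)
  rcases Nat.lt_or_ge V 91 with h' | h'
  · exact s2.2 V h (by omega)
  rcases Nat.lt_or_ge V 231 with h'' | h''
  · exact s3.2 V h' (by omega)
  rcases Nat.lt_or_ge V 331 with h''' | h'''
  · exact s4.2 V h'' (by omega)
  · exact s5.2 V h''' (by omega)

/-- **T_A arithmetic exclusion, orders `338 … 450`.** No `SieveAdmissible` shape list with at least two members beats
`τ = 2371/1000` at an order `338 ≤ M ≤ 450`. [original] -/
theorem not_beats_2371 (N M : ℕ) (a b c : Fin N → ℕ) (hN : 2 ≤ N) (h1 : 338 ≤ M) (h2 : M ≤ 450)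
    (hS : SieveAdmissible M a b c) : ¬ Beats (2371 / 1000) M a b c :=
  not_beats_of_checked checked_all hN h1 (by omega) (by simpa [Mtop] using h2) hS

end TAKnap

/-- **Rung leaf T_A/450 (closed).** No abelian STPP host of order `≤ 450` beats the record exponent `2.371`:
`Σ_i (|A_i||B_i||C_i|)^{2.371/3} ≤ |H|` for every STPP family in every finite abelian group `H` with `|H| ≤ 450` — no such family
certifies `ω < 2.371` through the Cohn–Umans/CKSU packing bound.  Orders `≤ 337`: `noAbelianSTPPHostUpTo_2371_337` (T_E/337 by
exponent monotonicity); orders `338 … 450`: vM soundness `AbelianTECensus.sieveSound` + the knapsack certificate `TAKnap.not_beats_2371`;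
degenerate / one-member families: `AbelianTECensus.noAbelianSTPPHostUpTo_of_two`.
WHAT THIS IS NOT: no bound on `ω`; a rung leaf (never summit credit); nothing about orders `> 450` or about the alive `5/2` lists.
[original] -/
theorem noAbelianSTPPHost_2371_450 : NoAbelianSTPPHost_2371_450 := by
  classical
  unfold NoAbelianSTPPHost_2371_450
  refine AbelianTECensus.noAbelianSTPPHostUpTo_of_two (τ := 2371 / 1000) (by norm_num) (by norm_num) ?_
  intro H _ _ hM N A B C hS hne hN
  by_cases h337 : Fintype.card H ≤ 337
  · exact noAbelianSTPPHostUpTo_2371_337 H h337 N A B C hS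
  · have hadm := AbelianTECensus.sieveSound H N A B C hS hne
    have h := TAKnap.not_beats_2371 N (Fintype.card H) _ _ _ hN (by omega) hM hadm
    unfold Beats at h
    rw [not_lt] at h
    simpa [shapeVol] using h

end Summit.MatrixMultiplication.MatrixMultiplication.Theorems
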